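import Summits.ResolutionOfSingularities.ResolutionOfSingularities.Theorems.WeightedInvariantWeightedConstructionACReduction
import Summits.ResolutionOfSingularities.ResolutionOfSingularities.Theorems.WeightedInvariantWeightedConstructionChartReduction
import Summits.ResolutionOfSingularities.ResolutionOfSingularities.Theorems.WeightedInvariantWeightedConstructionStaticDefs
import Summits.ResolutionOfSingularities.ResolutionOfSingularities.Theorems.WeightedInvariantWeightedConstructionExceptionalPrincipal
import Summits.ResolutionOfSingularities.ResolutionOfSingularities.Theorems.WeightedInvariantWeightedConstructionExceptionalSmooth
import Summits.ResolutionOfSingularities.ResolutionOfSingularities.Theorems.WeightedInvariantWeightedConstructionCobordantPlusOpenPieces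

/-!
# Static pre-datum ⇒ datum (Włodarczyk's Thm. 4.3.1 read statically) and the unconditional chart reductions

Route `ResolutionOfSingularities/WeightedInvariant`, crux `WeightedConstruction`
(stmt-ResolutionOfSingularities-0571, `∀ p prime, Nonempty (WeightedResolutionDatum p)`), line
`no-phi-rays-static-drop` (lead c2), registered stub `stub_staticReduction`.

A `StaticPreDatum p` (Theorems/…StaticDefs.lean) is the datum interface with the drop axiom `(iv)`
replaced by `(R)` RESTRICTION (monotonicity of `inv` along smooth, locally principal, `X`-regular closed
subschemes; Włodarczyk, arXiv:2203.03090, §4.2 property (3)) and `(CI)` the CONE DROP on the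
exceptional-divisor pair `(E(U), X'|_{E(U)})` of every chart open of its own centre — the punctured
weighted normal cone with the initial ideal (Lemma 4.1.5 = tree `cobordantAlgebra.nonempty_quotient_span_s_equiv`;
Lemma 4.1.7 = `stub_initialIdeal`, Theorems/…InitialIdeal.lean). We prove, keeping `Γ`, `inv`, `centre`:

* `StaticPreDatum.inv_lt_of_chart` — `(iv-chart)`: at a closed exceptional point `b` of a chart `B₊(U)`,
  lift `b` to a point `e` of `E(U)` (`stub_exceptional_point`), note that `E(U) → Spec k` is smooth
  (`stub_exceptional_smooth`) and that `E(U)` is principal with an `X'`-regular equation near every point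
  (`stub_exceptional_principal`), so `(R)` gives `inv(B₊(U), X')(b) ≤ inv(E(U), X'|_E)(e)` and `(CI)`
  gives `< max_Y inv` (Thm. 4.3.1: "`maxinv(B₊) < maxinv(Y)`", static half-page);
* `StaticPreDatum.toChartPreDatum`; `chartPreDatum_toPreDatum`, `acChartPreDatum_toPreDatum` — the landed
  conditional reductions (Theorems/…ChartReduction.lean, …ACReduction.lean) made UNCONDITIONAL by the open
  pieces `stub_openPieces` (Theorems/…CobordantPlusOpenPieces.lean);
* `stub_staticReduction` — `Nonempty (StaticPreDatum p) → Nonempty (WeightedResolutionDatum p)`.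
-/

noncomputable section

open CategoryTheory AlgebraicGeometry TopologicalSpace
open Literature.AlgebraicGeometry.Resolution
open scoped LaurentPolynomial

set_option linter.dupNamespace false -- mandated namespace of this single-conjunct summit

namespace Summit.ResolutionOfSingularities.ResolutionOfSingularities.Theorems


/-! ## Static pre-datum ⇒ chart pre-datum ⇒ pre-datum ⇒ datum -/

namespace StaticPreDatum

variable {p : ℕ} (S : StaticPreDatum p)

/-- **`(iv-chart)` for a static pre-datum** (Włodarczyk Thm. 4.3.1, static reading): at a closed
exceptional point `b` of a chart `B₊(U)`, lift `b` to `E(U)`, restrict by `(R)` (the exceptional divisor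
is smooth over `k` and principal with an `X'`-regular equation) and conclude by the cone drop `(CI)`. -/
theorem inv_lt_of_chart {k : Type} [Field k] [CharP k p] [PerfectField k]
    {Y : Scheme.{0}} (f : Y ⟶ Spec (.of k)) [Smooth f] [IsSeparated f] [QuasiCompact f]
    (X : Y.IdealSheafData) (hguard : ∃ y : Y, ¬ IsBot (S.inv f X y)) (U : Y.affineOpens)
    (hchart : ∃ (m : ℕ) (u : Fin m → Γ(Y, U)) (w : Fin m → ℕ), (S.centre f X).IsWeightedChart U u w)
    (hsm : Smooth ((S.centre f X).cobordantPlusι U ≫ f))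
    (hsep : IsSeparated ((S.centre f X).cobordantPlusι U ≫ f))
    (hqc : QuasiCompact ((S.centre f X).cobordantPlusι U ≫ f))
    (b : (S.centre f X).cobordantPlus U)
    (hb : (affineCobordantBlowup.plusOpens ((S.centre f X).chartIdeals U)).ι b ∈
      ((affineCobordantBlowup.exceptional ((S.centre f X).chartIdeals U)).support :
        Set (affineCobordantBlowup ((S.centre f X).chartIdeals U))))
    (y : Y) (hy : ∀ y' : Y, S.inv f X y' ≤ S.inv f X y) :
    S.inv ((S.centre f X).cobordantPlusι U ≫ f) ((S.centre f X).cobordantStrictTransform U X) b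
      < S.inv f X y := by
  obtain ⟨e, he⟩ := stub_exceptional_point (S.centre f X) U b hb
  haveI := hsm; haveI := hsep; haveI := hqc
  have hEsm : Smooth ((cobordantExceptional (S.centre f X) U).subschemeι ≫
      (S.centre f X).cobordantPlusι U ≫ f) :=
    stub_exceptional_smooth f (S.centre f X) U hchart hsm
  have hEsep : IsSeparated ((cobordantExceptional (S.centre f X) U).subschemeι ≫
      (S.centre f X).cobordantPlusι U ≫ f) := inferInstance
  have hEqc : QuasiCompact ((cobordantExceptional (S.centre f X) U).subschemeι ≫
      (S.centre f X).cobordantPlusι U ≫ f) := inferInstance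
  have h1 := S.inv_le_restrict ((S.centre f X).cobordantPlusι U ≫ f)
    ((S.centre f X).cobordantStrictTransform U X) (cobordantExceptional (S.centre f X) U) hEsm
    (stub_exceptional_principal (S.centre f X) U X) e
  rw [he] at h1
  exact lt_of_le_of_lt h1
    (S.inv_exceptional_lt f X hguard U hchart hsm hsep hqc hEsm hEsep hEqc e y hy)

/-- **A static pre-datum is a chart pre-datum** (same `Γ`, `inv`, `centre`). -/
def toChartPreDatum : ChartPreDatum p where
  Γ := S.Γ
  inv := S.inv
  centre := S.centre
  isClosed_superlevel := S.isClosed_superlevel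
  inv_comap := S.inv_comap
  inv_baseChange := S.inv_baseChange
  isBot_inv_iff := S.isBot_inv_iff
  isRegularWeightedCentre_centre := S.isRegularWeightedCentre_centre
  support_centre := S.support_centre
  centre_comap := S.centre_comap
  centre_baseChange := S.centre_baseChange
  inv_lt_of_chart := fun _ _ _ _ _ f _ _ _ X hguard U hchart hsm hsep hqc b _ hb y hy =>
    S.inv_lt_of_chart f X hguard U hchart hsm hsep hqc b hb y hy

end StaticPreDatum

/-- **Chart pre-datum ⇒ pre-datum, unconditional** (the landed `stub_chartPreDatum_toPreDatum_of` fed with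
the open pieces `stub_openPieces`). -/
theorem chartPreDatum_toPreDatum (p : ℕ) (h : Nonempty (ChartPreDatum p)) : Nonempty (PreDatum p) :=
  stub_chartPreDatum_toPreDatum_of stub_openPieces p h

/-- **Algebraically-closed chart pre-datum ⇒ pre-datum, unconditional** (the landed
`stub_acChartPreDatum_toPreDatum_of` fed with `stub_openPieces`). -/
theorem acChartPreDatum_toPreDatum (p : ℕ) (h : Nonempty (ACChartPreDatum p)) : Nonempty (PreDatum p) :=
  stub_acChartPreDatum_toPreDatum_of stub_openPieces p h

/-- **Static pre-datum ⇒ datum** (registered stub `stub_staticReduction` of line `no-phi-rays-static-drop`;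
Włodarczyk Thm. 4.3.1 read statically): a static pre-datum in characteristic `p` — `(usc)`, `(i)`, `(ii)`,
`(iii)`, RESTRICTION `(R)` and the cone drop `(CI)` — yields a weighted resolution datum in characteristic
`p` with the same `Γ`, `inv` and `centre`. [cite: Wlodarczyk2022, Thm. 4.3.1] -/
theorem stub_staticReduction :
    ∀ p : ℕ, Nonempty (StaticPreDatum p) → Nonempty (WeightedResolutionDatum p) := by
  rintro p ⟨S⟩
  exact stub_preDatum_toDatum p (chartPreDatum_toPreDatum p ⟨S.toChartPreDatum⟩)

end Summit.ResolutionOfSingularities.ResolutionOfSingularities.Theorems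

end
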